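import Summits.Ventures.HodgeRepro.CMHodgeSpan
import Summits.Ventures.HodgeRepro.CMHodgeOn

/-!
# Pohlmann's census on the kernel for CM algebras and for products of CM types (span form)

Blind re-derivation cell `pub-hodge-repro`, seat `typer-2` (gen 10).  The index-type-free version of this
seat's `CMHodgeSpan.lean` (gen 9: Galois CM fields), on `CMHodgeOn.lean`; reuses the abstract
`CMHodge.mem_span_image_of_forall_eq` (joint eigenvectors of operators diagonal in a basis).

**Theorem** (`jointEigenspaceOn_eq_span`): for a finite set `X`, ANY family `Ψ : Γ → Finset X` of subsets
and every `p`, the classes of `⋀^{2p} ℂ^X` on which every cocharacter `⋀^{2p} μ_{Ψ γ}(λ)` acts by `λ^p` are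
exactly the span of the coordinate wedges `e_S` (`S` a `2p`-set) with `|S ∩ Ψ γ| = p` for every `γ`
(`balancedWedgesOn`).  Specialisations through the dictionaries of `CMHodgeOn.lean`:

* CM algebras (`G`-sets, `GSetHodge.lean`): `jointEigenspaceOn_smul_eq_span_pohlmannWedgesOn` — the
  joint `λ^p`-eigenspace of the conjugate cocharacters `μ_{g • Φ}`, `g ∈ G`, is the span of the wedges `e_S`
  with `IsHodgeSetOn c Φ S` (Pohlmann's (9.2.1) on `X`);
* products of CM types of one Galois CM field (`FaceReduce.lean`): `jointEigenspaceOn_prod_eq_span` —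
  the joint `λ^p`-eigenspace of the conjugate cocharacters of the product type is the span of the wedges
  `e_S`, `S ⊆ J × G`, with `IsHodgeSetProd c Φ S`: typer's product Pohlmann condition describes exactly the
  `(p, p)`-classes of `∏_j A_{Φ j}` for all Galois conjugates — the combinatorial input of every face
  of `route/ROUTE.md` §3, now a kernel statement (the printed input is Deligne LNM 900 §3 / Ex. 3.7 +
  Milne's CM-algebra form of Pohlmann's theorem, as in ROUTE.md S2 / ROUTE-B §9.21).
-/

open Finset Module
open scoped Pointwise

namespace HodgeRepro.CMHodgeOn

section Basis

variable (X : Type*) [Fintype X] [DecidableEq X]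

/-- The coordinate basis of `ℂ^X`, indexed by `Fin |X|` through `Fintype.equivFin X`. -/
noncomputable def coordBasisOn : Basis (Fin (Fintype.card X)) ℂ (X → ℂ) :=
  (Pi.basisFun ℂ X).reindex (Fintype.equivFin X)

variable {X}

/-- `coordBasisOn X i = e_{(equivFin X)⁻¹ i}`. -/
theorem coordBasisOn_apply (i : Fin (Fintype.card X)) :
    coordBasisOn X i = coordVecOn ((Fintype.equivFin X).symm i) := by
  simp [coordBasisOn, Module.Basis.reindex_apply, Pi.basisFun_apply, coordVecOn]

/-- The injective enumeration of an `n`-element set `S` of basis indices, as points of `X`. -/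
noncomputable def enumOfOn (n : ℕ) (S : Set.powersetCard (Fin (Fintype.card X)) n) : Fin n → X :=
  fun i => (Fintype.equivFin X).symm (Set.powersetCard.ofFinEmbEquiv.symm S i)

omit [DecidableEq X] in
/-- `enumOfOn n S` is injective. -/
theorem enumOfOn_injective (n : ℕ) (S : Set.powersetCard (Fin (Fintype.card X)) n) :
    Function.Injective (enumOfOn n S) :=
  (Fintype.equivFin X).symm.injective.comp (Set.powersetCard.ofFinEmbEquiv.symm S).injective

/-- **The basis of `⋀^n ℂ^X` by coordinate wedges**: the exterior-power basis of `coordBasisOn X` at the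
`n`-set `S` is the coordinate wedge of the enumeration of `S`. -/
theorem coordBasisOn_exteriorPower_apply (n : ℕ) (S : Set.powersetCard (Fin (Fintype.card X)) n) :
    (coordBasisOn X).exteriorPower n S = coordWedgeOn n (enumOfOn n S) := by
  rw [exteriorPower.basis_apply]
  unfold exteriorPower.ιMulti_family coordWedgeOn
  congr 1
  funext i
  exact coordBasisOn_apply _

end Basis

section Span

variable {X : Type*} [Fintype X] [DecidableEq X] {Γ : Type*}

/-- The classes of `⋀^n ℂ^X` on which every cocharacter `μ_{Ψ γ}(λ)` of the family `Ψ` acts by `λ^p`. -/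
noncomputable def jointEigenspaceOn (Ψ : Γ → Finset X) (n p : ℕ) : Submodule ℂ (⋀[ℂ]^n (X → ℂ)) :=
  ⨅ (γ : Γ) (lam : ℂ), LinearMap.ker (exteriorPower.map n (cocharOn (Ψ γ) lam) - lam ^ p • LinearMap.id)

omit [Fintype X] in
/-- Membership in `jointEigenspaceOn`. -/
theorem mem_jointEigenspaceOn_iff (Ψ : Γ → Finset X) (n p : ℕ) (ω : ⋀[ℂ]^n (X → ℂ)) :
    ω ∈ jointEigenspaceOn Ψ n p ↔
      ∀ (γ : Γ) (lam : ℂ), exteriorPower.map n (cocharOn (Ψ γ) lam) ω = lam ^ p • ω := by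
  simp only [jointEigenspaceOn, Submodule.mem_iInf, LinearMap.mem_ker, LinearMap.sub_apply,
    LinearMap.smul_apply, LinearMap.id_apply, sub_eq_zero]

/-- The *balanced wedges* of the family `Ψ`: the coordinate wedges `e_S` of injective families `s` of
`2p` points with `|S ∩ Ψ γ| = p` for every `γ`. -/
def balancedWedgesOn (Ψ : Γ → Finset X) (p : ℕ) : Set (⋀[ℂ]^(2 * p) (X → ℂ)) :=
  {ω | ∃ s : Fin (2 * p) → X, Function.Injective s ∧ (∀ γ, (univ.image s ∩ Ψ γ).card = p) ∧
    coordWedgeOn (2 * p) s = ω}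

omit [Fintype X] in
/-- Every balanced wedge is a `(p, p)`-class for every `μ_{Ψ γ}`. -/
theorem span_balancedWedgesOn_le (Ψ : Γ → Finset X) (p : ℕ) :
    Submodule.span ℂ (balancedWedgesOn Ψ p) ≤ jointEigenspaceOn Ψ (2 * p) p := by
  rw [Submodule.span_le]
  rintro ω ⟨s, hs, hS, rfl⟩
  rw [SetLike.mem_coe, mem_jointEigenspaceOn_iff]
  exact (forall_map_cocharOn_eq_iff_forall_card_inter Ψ hs p).2 hS

/-- Every `(p, p)`-class for all `μ_{Ψ γ}` is a combination of balanced wedges (the cocharacters are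
diagonal in the basis of coordinate wedges; evaluate at `λ = 2`). -/
theorem jointEigenspaceOn_le_span (Ψ : Γ → Finset X) (p : ℕ) :
    jointEigenspaceOn Ψ (2 * p) p ≤ Submodule.span ℂ (balancedWedgesOn Ψ p) := by
  intro ω hω
  rw [mem_jointEigenspaceOn_iff] at hω
  have h := CMHodge.mem_span_image_of_forall_eq ((coordBasisOn X).exteriorPower (2 * p))
    (fun gl : Γ × ℂ => exteriorPower.map (2 * p) (cocharOn (Ψ gl.1) gl.2))
    (fun gl S => gl.2 ^ cornerCountOn (Ψ gl.1) (enumOfOn (2 * p) S))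
    (fun gl S => by rw [coordBasisOn_exteriorPower_apply]; exact map_cocharOn_coordWedgeOn _ _ _)
    (fun gl => gl.2 ^ p) (fun gl => hω gl.1 gl.2)
  refine Submodule.span_mono ?_ h
  rintro _ ⟨S, hS, rfl⟩
  refine ⟨enumOfOn (2 * p) S, enumOfOn_injective _ _, fun γ => ?_,
    (coordBasisOn_exteriorPower_apply _ _).symm⟩
  have h2 : (2 : ℂ) ^ cornerCountOn (Ψ γ) (enumOfOn (2 * p) S) = 2 ^ p := hS (γ, 2)
  rw [← cornerCountOn_eq_card_inter (Ψ γ) (enumOfOn_injective _ _)]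
  have h' : ((2 ^ cornerCountOn (Ψ γ) (enumOfOn (2 * p) S) : ℕ) : ℂ) = ((2 ^ p : ℕ) : ℂ) := by
    push_cast
    exact h2
  exact Nat.pow_right_injective (le_refl 2) (Nat.cast_injective h')

/-- **The joint `λ^p`-eigenspace of a family of cocharacters is the span of its balanced wedges.** -/
theorem jointEigenspaceOn_eq_span (Ψ : Γ → Finset X) (p : ℕ) :
    jointEigenspaceOn Ψ (2 * p) p = Submodule.span ℂ (balancedWedgesOn Ψ p) :=
  le_antisymm (jointEigenspaceOn_le_span Ψ p) (span_balancedWedgesOn_le Ψ p)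

end Span

/-! ### CM algebras: Pohlmann's census on a `G`-set -/

section GSet

variable {G : Type*} [Group G] {X : Type*} [MulAction G X] [Fintype X] [DecidableEq X]

/-- **Pohlmann's wedges on `X`**: the coordinate wedges `e_S` of injective families of `2p` points whose
corner set satisfies Pohlmann's condition `IsHodgeSetOn c Φ S` (GSetHodge.lean). -/
def pohlmannWedgesOn (c : G) (Φ : Finset X) (p : ℕ) : Set (⋀[ℂ]^(2 * p) (X → ℂ)) :=
  {ω | ∃ s : Fin (2 * p) → X, Function.Injective s ∧ IsHodgeSetOn c Φ (univ.image s) ∧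
    coordWedgeOn (2 * p) s = ω}

/-- Pohlmann's wedges are the balanced wedges of the family of Galois translates `g • Φ`. -/
theorem pohlmannWedgesOn_eq_balancedWedgesOn {c : G} (hc : IsComplexConj c) {Φ : Finset X}
    (hΦ : IsCMTypeOn c Φ) (p : ℕ) :
    pohlmannWedgesOn c Φ p = balancedWedgesOn (fun g : G => g • Φ) p := by
  ext ω
  constructor
  · rintro ⟨s, hs, hS, rfl⟩
    refine ⟨s, hs, ?_, rfl⟩
    rwa [isHodgeSetOn_iff_forall_card_eq hc hΦ _ p
      (by rw [Finset.card_image_of_injective _ hs, Finset.card_univ, Fintype.card_fin])] at hS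
  · rintro ⟨s, hs, hS, rfl⟩
    refine ⟨s, hs, ?_, rfl⟩
    rwa [isHodgeSetOn_iff_forall_card_eq hc hΦ _ p
      (by rw [Finset.card_image_of_injective _ hs, Finset.card_univ, Fintype.card_fin])]

/-- **Pohlmann's census for CM algebras on the kernel**: the `(p, p)`-classes of `⋀^{2p} ℂ^X` for all
conjugate cocharacters `μ_{g • Φ}` are exactly the span of the wedges `e_S` with `IsHodgeSetOn c Φ S`. -/
theorem jointEigenspaceOn_smul_eq_span_pohlmannWedgesOn {c : G} (hc : IsComplexConj c) {Φ : Finset X}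
    (hΦ : IsCMTypeOn c Φ) (p : ℕ) :
    jointEigenspaceOn (fun g : G => g • Φ) (2 * p) p = Submodule.span ℂ (pohlmannWedgesOn c Φ p) := by
  rw [pohlmannWedgesOn_eq_balancedWedgesOn hc hΦ p]
  exact jointEigenspaceOn_eq_span _ p

end GSet

/-! ### Products of CM types: the faces' Hodge classes -/

section Prod

variable {G : Type*} [Group G] [Fintype G] [DecidableEq G] {J : Type*} [Fintype J] [DecidableEq J]

/-- The Pohlmann wedges of a product of CM types: the coordinate wedges `e_S`, `S ⊆ J × G` a `2p`-set
with `IsHodgeSetProd c Φ S` (typer's product condition, FaceReduce.lean). -/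
def pohlmannProdWedges (c : G) (Φ : J → Finset G) (p : ℕ) : Set (⋀[ℂ]^(2 * p) ((J × G) → ℂ)) :=
  {ω | ∃ s : Fin (2 * p) → J × G, Function.Injective s ∧ IsHodgeSetProd c Φ (univ.image s) ∧
    coordWedgeOn (2 * p) s = ω}

/-- The product Pohlmann wedges are the balanced wedges of the conjugate product type sets. -/
theorem pohlmannProdWedges_eq_balancedWedgesOn {c : G} (hc : IsComplexConj c) {Φ : J → Finset G}
    (hΦ : ∀ k, IsCMType c (Φ k)) (p : ℕ) :
    pohlmannProdWedges c Φ p = balancedWedgesOn (fun g : G => prodTypeSet fun j => g • Φ j) p := by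
  ext ω
  constructor
  · rintro ⟨s, hs, hS, rfl⟩
    refine ⟨s, hs, ?_, rfl⟩
    rw [← forall_map_cocharOn_eq_iff_forall_card_inter _ hs p]
    exact (isHodgeSetProd_iff_forall_map_cocharOn_eq hc hΦ hs).1 hS
  · rintro ⟨s, hs, hS, rfl⟩
    refine ⟨s, hs, ?_, rfl⟩
    rw [isHodgeSetProd_iff_forall_map_cocharOn_eq hc hΦ hs]
    exact (forall_map_cocharOn_eq_iff_forall_card_inter _ hs p).2 hS

/-- **Pohlmann's census for a product of CM types on the kernel**: the `(p, p)`-classes of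
`⋀^{2p} ℂ^{J × G}` for all conjugate cocharacters of the product type are exactly the span of the wedges
`e_S` with `IsHodgeSetProd c Φ S` — the Hodge classes of `∏_j A_{Φ j}` used by every face of ROUTE.md §3. -/
theorem jointEigenspaceOn_prod_eq_span {c : G} (hc : IsComplexConj c) {Φ : J → Finset G}
    (hΦ : ∀ k, IsCMType c (Φ k)) (p : ℕ) :
    jointEigenspaceOn (fun g : G => prodTypeSet fun j => g • Φ j) (2 * p) p =
      Submodule.span ℂ (pohlmannProdWedges c Φ p) := by
  rw [pohlmannProdWedges_eq_balancedWedgesOn hc hΦ p]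
  exact jointEigenspaceOn_eq_span _ p

end Prod

end HodgeRepro.CMHodgeOn
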